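import Summits.BirchSwinnertonDyer.Rank1Residual.Additive.X3BranchKummerLayerTwistedZeta
import Summits.BirchSwinnertonDyer.Rank1Residual.Additive.X3BranchLayerTwoField
import HarnessLib

/-!
# X3, the DEGENERATE rows OFF the sub-locus, T-SIDE OVER THE SECOND LAYER: `ζ₂₇` under an element
# fixing `θ₂ = ζ₂₇ + ζ₂₇²⁶` — it maps `ζ₂₇` to `ζ₂₇` or `ζ₂₇²⁶ = ζ₂₇⁻¹`, according to its action on
# `ζ₃ = ζ₂₇⁹` (cell `bsd-eis`, seat `bsd-eis-x3` gen 8; the second-layer analogue of gen 7's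
# `X3BranchKummerLayerTwistedZeta.lean`: the glue between the layer group `G₂` (which fixes `θ₂`,
# `LayerTwoField.zeta_add_pow_mem_layer_two`) and the hypotheses `hfix` / `hflip` of
# `KummerLayerTwisted.exists_twistedKummerChar` for radicals of elements `b = B(ζ₂₇) ∈ ℤ[ζ₂₇]`
# (x3-MEMO-10 §5 (f)); route K1 `AdditiveBranchIMC`, crux `GordTwoRankZeroOffCaseOne` — supports only)

HONEST FRAMING (`run/shared/lean/pub/bsd-eis/README.md` §4): THEOREMS ONLY (no `def`, no named fact,
no `sorry`); nothing is booked; no label, tier or count of record moves.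

## What

`ℚ(ζ₂₇) = ℚ_2(ζ₃)` is quadratic over the second layer `ℚ_2 = ℚ(θ₂)`, `θ₂ = ζ₂₇ + ζ₂₇⁻¹`; an element
`σ ∈ Γ_ℚ` fixing `θ₂` permutes the two roots `ζ₂₇^{±1}` of `X² − θ₂X + 1`:
* `smul_zeta27_eq_or_of_smul_theta27` — `σζ ∈ {ζ, ζ²⁶}` (from `xζ(x + x²⁶ − ζ − ζ²⁶) = (xζ − 1)(x − ζ)`
  for `x²⁷ = ζ²⁷ = 1`);
* `smul_zeta27_eq_self_of_smul_pow_nine` / `smul_zeta27_eq_pow_26_of_smul_pow_nine_ne` — the case is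
  decided by the action on `ζ₃ = ζ⁹` (`(ζ²⁶)⁹ = ζ¹⁸ ≠ ζ⁹`);
* `smul_aeval_zeta27_eq_self` / `smul_aeval_zeta27_eq_aeval_pow_26` — hence `σ(B(ζ)) = B(ζ)`, resp.
  `= B(ζ²⁶)`, for every integer polynomial `B`.
References: [Washington1997] §2 (cyclotomic fields, `ℚ(ζ_n)⁺`); [SerreLocalFields1979] Ch. X §3.
-/

set_option autoImplicit false

noncomputable section

open scoped Classical

namespace Summit.BirchSwinnertonDyer.Rank1Residual.Additive

namespace KummerLayerTwisted

open Field Polynomial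
open Literature.NumberTheory.GaloisRepresentations Literature.NumberTheory.EllipticCurves

/-- **`σζ ∈ {ζ, ζ²⁶}` for `σ` fixing `θ₂ = ζ + ζ²⁶`** (`ζ²⁷ = 1`). With `x = σζ`:
`xζ·(x + x²⁶ − ζ − ζ²⁶) = (xζ − 1)(x − ζ)`, so `x = ζ` or `xζ = 1`, i.e. `x = ζ²⁶`. [folklore] -/
theorem smul_zeta27_eq_or_of_smul_theta27 {ζ : AlgebraicClosure ℚ} (hζ : IsPrimitiveRoot ζ 27)
    {σ : absoluteGaloisGroup ℚ} (hθ : σ • (ζ + ζ ^ 26) = ζ + ζ ^ 26) :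
    σ • ζ = ζ ∨ σ • ζ = ζ ^ 26 := by
  have hζ27 : ζ ^ 27 = 1 := hζ.pow_eq_one
  have hx27 : (σ • ζ) ^ 27 = 1 := by rw [← smul_pow', hζ27, smul_one]
  have hθ' : σ • ζ + (σ • ζ) ^ 26 = ζ + ζ ^ 26 := by rwa [smul_add, smul_pow'] at hθ
  have key : (σ • ζ * ζ - 1) * (σ • ζ - ζ) = 0 := by
    linear_combination (σ • ζ * ζ) * hθ' - ζ * hx27 + (σ • ζ) * hζ27
  rcases mul_eq_zero.mp key with h | h
  · right
    have hζ0 : ζ ≠ 0 := hζ.ne_zero (by norm_num)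
    have h1 : σ • ζ * ζ = ζ ^ 26 * ζ := by
      rw [sub_eq_zero] at h
      rw [h, ← pow_succ, hζ27]
    exact mul_right_cancel₀ hζ0 h1
  · left
    exact sub_eq_zero.mp h

/-- `ζ₂₇⁹` is a primitive cube root of unity. [folklore] -/
theorem isPrimitiveRoot_zeta27_pow_nine {ζ : AlgebraicClosure ℚ} (hζ : IsPrimitiveRoot ζ 27) :
    IsPrimitiveRoot (ζ ^ 9) 3 :=
  hζ.pow (by norm_num) (by norm_num)

/-- `ζ₂₇³` is a primitive `9`-th root of unity. [folklore] -/
theorem isPrimitiveRoot_zeta27_cube {ζ : AlgebraicClosure ℚ} (hζ : IsPrimitiveRoot ζ 27) :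
    IsPrimitiveRoot (ζ ^ 3) 9 :=
  hζ.pow (by norm_num) (by norm_num)

/-- `ζ₂₇¹⁸ ≠ ζ₂₇⁹` (`ζ₂₇⁹ ≠ 1`). [folklore] -/
theorem zeta27_pow_eighteen_ne_pow_nine {ζ : AlgebraicClosure ℚ} (hζ : IsPrimitiveRoot ζ 27) :
    ζ ^ 18 ≠ ζ ^ 9 := by
  intro h
  have h9 : ζ ^ 9 ≠ 0 := pow_ne_zero 9 (hζ.ne_zero (by norm_num))
  have h1 : ζ ^ 9 * ζ ^ 9 = 1 * ζ ^ 9 := by rw [← pow_add, one_mul]; exact h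
  have h91 : ζ ^ 9 = 1 := mul_right_cancel₀ h9 h1
  exact (hζ.pow_ne_one_of_pos_of_lt (by norm_num) (by norm_num)) h91

/-- **`σ` fixing `θ₂` and `ζ₃ = ζ⁹` fixes `ζ`.** [folklore] -/
theorem smul_zeta27_eq_self_of_smul_pow_nine {ζ : AlgebraicClosure ℚ} (hζ : IsPrimitiveRoot ζ 27)
    {σ : absoluteGaloisGroup ℚ} (hθ : σ • (ζ + ζ ^ 26) = ζ + ζ ^ 26) (h9 : σ • ζ ^ 9 = ζ ^ 9) :
    σ • ζ = ζ := by
  rcases smul_zeta27_eq_or_of_smul_theta27 hζ hθ with h | h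
  · exact h
  · exfalso
    rw [smul_pow', h, ← pow_mul, show 26 * 9 = 27 * 8 + 18 from rfl, pow_add, pow_mul,
      hζ.pow_eq_one, one_pow, one_mul] at h9
    exact zeta27_pow_eighteen_ne_pow_nine hζ h9

/-- **`σ` fixing `θ₂` and moving `ζ₃ = ζ⁹` maps `ζ` to `ζ²⁶ = ζ⁻¹`.** [folklore] -/
theorem smul_zeta27_eq_pow_26_of_smul_pow_nine_ne {ζ : AlgebraicClosure ℚ}
    (hζ : IsPrimitiveRoot ζ 27) {σ : absoluteGaloisGroup ℚ} (hθ : σ • (ζ + ζ ^ 26) = ζ + ζ ^ 26)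
    (h9 : σ • ζ ^ 9 ≠ ζ ^ 9) : σ • ζ = ζ ^ 26 := by
  rcases smul_zeta27_eq_or_of_smul_theta27 hζ hθ with h | h
  · exact absurd (by rw [smul_pow', h]) h9
  · exact h

/-- **`hfix`**: `σ` fixing `θ₂` and `ζ₃` fixes every `B(ζ)`, `B ∈ ℤ[X]`. [folklore] -/
theorem smul_aeval_zeta27_eq_self {ζ : AlgebraicClosure ℚ} (hζ : IsPrimitiveRoot ζ 27) (B : ℤ[X])
    {σ : absoluteGaloisGroup ℚ} (hθ : σ • (ζ + ζ ^ 26) = ζ + ζ ^ 26) (h9 : σ • ζ ^ 9 = ζ ^ 9) :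
    σ • aeval ζ B = aeval ζ B := by
  rw [smul_aeval_eq, smul_zeta27_eq_self_of_smul_pow_nine hζ hθ h9]

/-- **`hflip`**: `σ` fixing `θ₂` and moving `ζ₃` maps `B(ζ)` to `B(ζ²⁶)`, `B ∈ ℤ[X]`. [folklore] -/
theorem smul_aeval_zeta27_eq_aeval_pow_26 {ζ : AlgebraicClosure ℚ} (hζ : IsPrimitiveRoot ζ 27)
    (B : ℤ[X]) {σ : absoluteGaloisGroup ℚ} (hθ : σ • (ζ + ζ ^ 26) = ζ + ζ ^ 26)
    (h9 : σ • ζ ^ 9 ≠ ζ ^ 9) : σ • aeval ζ B = aeval (ζ ^ 26) B := by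
  rw [smul_aeval_eq, smul_zeta27_eq_pow_26_of_smul_pow_nine_ne hζ hθ h9]

/-- **The layer group `G₂` fixes `θ₂`** (`θ₂ ∈ ℚ_2 = κ.layer 2` for every cyclotomic `κ`).
[cite: Washington1997, §13.1] -/
theorem smul_theta27_eq_self_of_mem_layerSubgroup_two {κ : ZpExtension ℚ 3} (hκ : κ.IsCyclotomic)
    {ζ : AlgebraicClosure ℚ} (hζ : IsPrimitiveRoot ζ 27) {σ : absoluteGaloisGroup ℚ}
    (hσ : σ ∈ κ.layerSubgroup 2) : σ • (ζ + ζ ^ 26) = ζ + ζ ^ 26 := by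
  have hmem := LayerTwoField.zeta_add_pow_mem_layer_two hκ ζ hζ.pow_eq_one
  rw [ZpExtension.layer, IntermediateField.mem_fixedField_iff] at hmem
  exact hmem _ (Subgroup.mem_map.mpr ⟨σ, hσ, rfl⟩)

end KummerLayerTwisted

end Summit.BirchSwinnertonDyer.Rank1Residual.Additive

end
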